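/-
Copyright (c) 2026. All rights reserved.
Released under Apache 2.0 license as described in the file LICENSE.
-/
import Literature.Analysis.FunctionSpaces.BesselJAlternatingBound
import Literature.Analysis.FunctionSpaces.BesselJZeroSeriesRemainder
import HarnessLib

/-!
# A kernel-decidable certificate for rational Bessel-`J` literals

Given an argument `y ∈ ℚ`, a denominator `den`, a truncation order `N`, an accuracy `eps ∈ ℚ` and integer
numerators `Q j` (`j < L`), the `Bool` `JLit.Cert.check` decides, entry by entry and in exact rational
arithmetic, the side condition `j ≤ 1 ∨ y² ≤ 4(j+1)` and the two inequalities
`Q_j/den − eps ≤ S_N(j,y) − |t_N(j,y)|`, `S_N(j,y) + |t_N(j,y)| ≤ Q_j/den + eps`, where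
`S_N(j,y) = Σ_{k<N} (−1)^k (y/2)^{2k+j}/(k!(k+j)!)` is the exact rational partial sum of the ascending series of
`J_j(y)` and `t_N` its first omitted term; `JLit.Cert.sound` turns `check = true` into
**`|Q_j/den − J_j(y)| ≤ eps` for every `j < L`**.  The analytic input is the sharp "first omitted term"
remainder, valid for orders `0, 1` at every real argument (`BesselJZeroSeriesRemainder`:
`abs_besselJ_zero_sub_sum_range_le_abs_besselJTerm`, `abs_besselJ_one_sub_sum_range_le_abs_besselJTerm`, from the
Poisson integrals) and for every order in the Leibniz regime `y² ≤ 4(j+1)` (`BesselJAlternatingBound`: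
`abs_besselJ_sub_sum_range_le_abs_besselJTerm_of_sq_le`); together they cover every `(j, y)` with `|y| ≤ 2√3`.

Consumer-shaped corollaries (coefficient rows `c_j = 2π iʲ J_j(y)` of Fourier–Bessel expansions against
rational rows `c'_j = 2π iʲ q_j`): `JLit.norm_coeff_sub_coeff_le` (`‖c_j − c'_j‖ ≤ 2π·eps`) and
`JLit.Cert.sum_weight_norm_coeff_sub_le` (`Σ_{j≤J} ε_j ‖c_j − c'_j‖ ≤ (2J+1)·2π·eps`, `ε_0 = 1`, `ε_j = 2`),
with `_of_eq` variants at a real argument `x` provably equal to `y` (e.g. `x = β/d`).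

Everything is free of any dimension or lattice quantity: a reusable validated-numerics device for the
classical function `J_n`.  One small instance (`y = 1/2`, orders `0 … 3`, six digits) is decided in-file to
show that the check reduces in the kernel.  (b2b-lace packet, what-if / input-certification SUPPORT: the
device lets the coefficient error of a Bessel row with rational literals be a kernel theorem; nothing here is
a certificate of a lace-expansion quantity and no dimension-specific sentence is made.)

References: NIST DLMF §10.2.2 (series), §10.9.1–10.9.2 (Bessel/Poisson integrals), §10.14 (bounds) [DLMF];
G. N. Watson, *A Treatise on the Theory of Bessel Functions* (1944), §2.11 (the alternating series) [Watson1944].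
-/

set_option Elab.async false

noncomputable section

namespace Literature.Analysis.FunctionSpaces

namespace JLit

open Finset

/-! ### Exact rational series data -/

/-- The `k`-th term `(−1)^k (y/2)^{2k+n}/(k!(k+n)!)` of the ascending series of `J_n(y)` as an exact rational.
[cite: DLMF, 10.2.2] -/
def termQ (n : ℕ) (y : ℚ) (k : ℕ) : ℚ :=
  (-1 : ℚ) ^ k / ((k.factorial : ℚ) * ((k + n).factorial : ℚ)) * (y / 2) ^ (2 * k + n)

/-- The exact rational partial sum `S_N = Σ_{k<N} termQ n y k` (structural recursion, kernel-friendly).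
[cite: DLMF, 10.2.2] -/
def psumQ (n : ℕ) (y : ℚ) : ℕ → ℚ
  | 0 => 0
  | N + 1 => psumQ n y N + termQ n y N

/-- `termQ` is the rational form of `besselJTerm`. [cite: DLMF, 10.2.2] -/
theorem cast_termQ (n : ℕ) (y : ℚ) (k : ℕ) : ((termQ n y k : ℚ) : ℝ) = besselJTerm n (y : ℝ) k := by
  simp only [termQ, besselJTerm]
  push_cast
  ring

/-- `psumQ` is the rational form of the partial sum `Σ_{k<N} besselJTerm n y k`. [cite: DLMF, 10.2.2] -/
theorem cast_psumQ (n : ℕ) (y : ℚ) (N : ℕ) :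
    ((psumQ n y N : ℚ) : ℝ) = ∑ k ∈ Finset.range N, besselJTerm n (y : ℝ) k := by
  induction N with
  | zero => simp [psumQ]
  | succ N ih => rw [psumQ, Rat.cast_add, ih, cast_termQ, Finset.sum_range_succ]

/-- **Uniform sharp remainder**: for `n ≤ 1` (every real argument) or in the Leibniz regime `x² ≤ 4(n+1)`,
`|J_n(x) − Σ_{k<N} besselJTerm n x k| ≤ |besselJTerm n x N|`.
[cite: DLMF, 10.2.2; Watson1944, §2.11] -/
theorem abs_besselJ_sub_sum_range_le (n : ℕ) (x : ℝ) (h : n ≤ 1 ∨ x ^ 2 ≤ 4 * ((n : ℝ) + 1)) (N : ℕ) :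
    |besselJ n x - ∑ k ∈ Finset.range N, besselJTerm n x k| ≤ |besselJTerm n x N| := by
  rcases h with h | h
  · interval_cases n
    · exact abs_besselJ_zero_sub_sum_range_le_abs_besselJTerm x N
    · exact abs_besselJ_one_sub_sum_range_le_abs_besselJTerm x N
  · exact abs_besselJ_sub_sum_range_le_abs_besselJTerm_of_sq_le n h N

/-! ### The certificate -/

/-- Data of a rational Bessel-`J` literal certificate: the argument `y`, the common denominator `den` of the
literals, the series truncation `N`, the claimed accuracy `eps`, the number of orders `L` and the integer
numerators `Q j ≈ den · J_j(y)`, `j < L`. [cite: DLMF, 10.2.2] -/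
structure Cert where
  /-- the argument -/
  y : ℚ
  /-- common denominator of the literals -/
  den : ℕ
  /-- truncation order of the ascending series -/
  N : ℕ
  /-- claimed absolute accuracy -/
  eps : ℚ
  /-- number of orders `j = 0, …, L-1` -/
  L : ℕ
  /-- numerators: `Q j / den ≈ J_j(y)` -/
  Q : ℕ → ℤ

namespace Cert

variable (c : Cert)

/-- The rational literal `q_j = Q_j / den`. [cite: DLMF, 10.2.2] -/
def q (j : ℕ) : ℚ := (c.Q j : ℚ) / (c.den : ℚ)

/-- The per-entry check: side condition of the remainder bound and the two rational inequalities placing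
the Leibniz bracket `[S_N − |t_N|, S_N + |t_N|]` inside `[q_j − eps, q_j + eps]`. [cite: DLMF, 10.2.2; Watson1944, §2.11] -/
def entryOK (j : ℕ) : Bool :=
  (decide (j ≤ 1) || decide (c.y ^ 2 ≤ 4 * ((j : ℚ) + 1))) &&
    (decide (c.q j - c.eps ≤ psumQ j c.y c.N - |termQ j c.y c.N|) &&
      decide (psumQ j c.y c.N + |termQ j c.y c.N| ≤ c.q j + c.eps))

/-- The certificate check (a `Bool`, decided by `decide` in the kernel on literal data). [cite: DLMF, 10.2.2] -/
def check : Bool :=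
  decide (0 < c.den) && (List.range c.L).all c.entryOK

/-- `check = true` gives the per-entry check of every order `j < L`. [cite: DLMF, 10.2.2] -/
theorem entryOK_of_check (h : c.check = true) {j : ℕ} (hj : j < c.L) : c.entryOK j = true := by
  rw [check, Bool.and_eq_true, List.all_eq_true] at h
  exact h.2 j (List.mem_range.2 hj)

/-- `check = true` gives `0 < den`. [cite: DLMF, 10.2.2] -/
theorem den_pos_of_check (h : c.check = true) : 0 < c.den := by
  rw [check, Bool.and_eq_true, decide_eq_true_eq] at h
  exact h.1

/-- The cast of the literal: `((q_j : ℚ) : ℝ) = (Q_j : ℝ) / den`. [cite: DLMF, 10.2.2] -/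
theorem cast_q (j : ℕ) : ((c.q j : ℚ) : ℝ) = ((c.Q j : ℤ) : ℝ) / (c.den : ℝ) := by
  rw [q]; push_cast; rfl

/-- **Soundness, one entry.** [cite: DLMF, 10.2.2; Watson1944, §2.11] -/
theorem abs_sub_le_of_entryOK {j : ℕ} (h : c.entryOK j = true) :
    |((c.q j : ℚ) : ℝ) - besselJ j (c.y : ℝ)| ≤ (c.eps : ℝ) := by
  rw [entryOK, Bool.and_eq_true, Bool.and_eq_true, Bool.or_eq_true, decide_eq_true_eq, decide_eq_true_eq,
    decide_eq_true_eq, decide_eq_true_eq] at h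
  obtain ⟨hside, hlo, hhi⟩ := h
  have hside' : j ≤ 1 ∨ ((c.y : ℚ) : ℝ) ^ 2 ≤ 4 * ((j : ℝ) + 1) := by
    rcases hside with h1 | h1
    · exact Or.inl h1
    · right; exact_mod_cast h1
  have hrem := abs_besselJ_sub_sum_range_le j ((c.y : ℚ) : ℝ) hside' c.N
  rw [← cast_psumQ, ← cast_termQ, ← Rat.cast_abs, abs_sub_le_iff] at hrem
  have hlo' : ((c.q j : ℚ) : ℝ) - (c.eps : ℝ) ≤ ((psumQ j c.y c.N : ℚ) : ℝ) - ((|termQ j c.y c.N| : ℚ) : ℝ) := by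
    exact_mod_cast hlo
  have hhi' : ((psumQ j c.y c.N : ℚ) : ℝ) + ((|termQ j c.y c.N| : ℚ) : ℝ) ≤ ((c.q j : ℚ) : ℝ) + (c.eps : ℝ) := by
    exact_mod_cast hhi
  rw [abs_sub_le_iff]
  constructor <;> linarith [hrem.1, hrem.2]

/-- **Soundness.** If the certificate checks, every literal is within `eps` of the Bessel value:
`|Q_j/den − J_j(y)| ≤ eps` for all `j < L`. [cite: DLMF, 10.2.2; Watson1944, §2.11] -/
theorem sound (h : c.check = true) {j : ℕ} (hj : j < c.L) :
    |((c.Q j : ℤ) : ℝ) / (c.den : ℝ) - besselJ j (c.y : ℝ)| ≤ (c.eps : ℝ) := by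
  rw [← cast_q]
  exact c.abs_sub_le_of_entryOK (c.entryOK_of_check h hj)

/-- Soundness as a two-sided enclosure `J_j(y) ∈ [Q_j/den − eps, Q_j/den + eps]`. [cite: DLMF, 10.2.2] -/
theorem besselJ_mem_Icc (h : c.check = true) {j : ℕ} (hj : j < c.L) :
    besselJ j (c.y : ℝ) ∈ Set.Icc (((c.Q j : ℤ) : ℝ) / (c.den : ℝ) - c.eps) (((c.Q j : ℤ) : ℝ) / (c.den : ℝ) + c.eps) := by
  have h1 := c.sound h hj
  rw [abs_sub_le_iff] at h1
  constructor <;> linarith [h1.1, h1.2]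

end Cert

/-! ### Consumer-shaped corollaries: Fourier–Bessel coefficient rows -/

/-- For a real `q` with `|q − J_j(y)| ≤ e`: `‖2π iʲ J_j(y) − 2π iʲ q‖ ≤ 2π e` (the coefficient shape of
Bessel rows `Σ_j ε_j I_{jm}(v) · 2π iʲ J_j(y)`). [cite: DLMF, 10.2.2] -/
theorem norm_coeff_sub_coeff_le (j : ℕ) {y q e : ℝ} (h : |q - besselJ j y| ≤ e) :
    ‖2 * Real.pi * Complex.I ^ j * (besselJ j y : ℂ) - 2 * Real.pi * Complex.I ^ j * (q : ℂ)‖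
      ≤ 2 * Real.pi * e := by
  rw [← mul_sub, norm_mul, norm_mul, norm_pow, Complex.norm_I, one_pow, mul_one, ← Complex.ofReal_sub,
    Complex.norm_real, Real.norm_eq_abs, abs_sub_comm]
  have h2 : ‖(2 : ℂ) * Real.pi‖ = 2 * Real.pi := by
    rw [norm_mul, Complex.norm_real, Real.norm_eq_abs, abs_of_pos Real.pi_pos]
    simp
  rw [h2]
  exact mul_le_mul_of_nonneg_left h (by positivity)

namespace Cert

variable (c : Cert)

/-- The coefficient form of soundness: `‖2π iʲ J_j(y) − 2π iʲ (Q_j/den)‖ ≤ 2π·eps`, `j < L`.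
[cite: DLMF, 10.2.2] -/
theorem norm_coeff_sub_le (h : c.check = true) {j : ℕ} (hj : j < c.L) :
    ‖2 * Real.pi * Complex.I ^ j * (besselJ j (c.y : ℝ) : ℂ)
        - 2 * Real.pi * Complex.I ^ j * ((((c.Q j : ℤ) : ℝ) / (c.den : ℝ) : ℝ) : ℂ)‖ ≤ 2 * Real.pi * c.eps :=
  norm_coeff_sub_coeff_le j (c.sound h hj)

/-- **Weighted row sum.** For `J + 1 ≤ L`:
`Σ_{j ≤ J} ε_j ‖2π iʲ J_j(y) − 2π iʲ Q_j/den‖ ≤ (2J+1) · 2π · eps` (`ε_0 = 1`, `ε_j = 2`), the `η` of a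
finite Bessel row with rational literals. [cite: DLMF, 10.2.2] -/
theorem sum_weight_norm_coeff_sub_le (h : c.check = true) {J : ℕ} (hJ : J + 1 ≤ c.L) :
    ∑ j ∈ Finset.range (J + 1), (if j = 0 then (1 : ℝ) else 2)
        * ‖2 * Real.pi * Complex.I ^ j * (besselJ j (c.y : ℝ) : ℂ)
            - 2 * Real.pi * Complex.I ^ j * ((((c.Q j : ℤ) : ℝ) / (c.den : ℝ) : ℝ) : ℂ)‖
      ≤ (2 * J + 1) * (2 * Real.pi * c.eps) := by
  have hε : ∀ K : ℕ, ∑ j ∈ Finset.range (K + 1), (if j = 0 then (1 : ℝ) else 2) = 2 * K + 1 := by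
    intro K
    induction K with
    | zero => simp
    | succ K ih =>
      rw [Finset.sum_range_succ, ih, if_neg (Nat.succ_ne_zero K)]
      push_cast; ring
  calc ∑ j ∈ Finset.range (J + 1), (if j = 0 then (1 : ℝ) else 2)
        * ‖2 * Real.pi * Complex.I ^ j * (besselJ j (c.y : ℝ) : ℂ)
            - 2 * Real.pi * Complex.I ^ j * ((((c.Q j : ℤ) : ℝ) / (c.den : ℝ) : ℝ) : ℂ)‖
      ≤ ∑ j ∈ Finset.range (J + 1), (if j = 0 then (1 : ℝ) else 2) * (2 * Real.pi * c.eps) := by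
        refine Finset.sum_le_sum fun j hj => ?_
        have hjL : j < c.L := by have := Finset.mem_range.1 hj; omega
        have hw : (0 : ℝ) ≤ (if j = 0 then (1 : ℝ) else 2) := by split_ifs <;> norm_num
        exact mul_le_mul_of_nonneg_left (c.norm_coeff_sub_le h hjL) hw
    _ = (2 * J + 1) * (2 * Real.pi * c.eps) := by rw [← Finset.sum_mul, hε J]

/-- `sound` at a real argument `x` provably equal to the rational `y` (e.g. `x = β/d` with `β/d = y`).
[cite: DLMF, 10.2.2] -/
theorem sound_of_eq (h : c.check = true) {x : ℝ} (hx : ((c.y : ℚ) : ℝ) = x) {j : ℕ} (hj : j < c.L) :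
    |((c.Q j : ℤ) : ℝ) / (c.den : ℝ) - besselJ j x| ≤ (c.eps : ℝ) :=
  hx ▸ c.sound h hj

/-- `sum_weight_norm_coeff_sub_le` at a real argument `x` provably equal to the rational `y`.
[cite: DLMF, 10.2.2] -/
theorem sum_weight_norm_coeff_sub_le_of_eq (h : c.check = true) {x : ℝ} (hx : ((c.y : ℚ) : ℝ) = x) {J : ℕ}
    (hJ : J + 1 ≤ c.L) :
    ∑ j ∈ Finset.range (J + 1), (if j = 0 then (1 : ℝ) else 2)
        * ‖2 * Real.pi * Complex.I ^ j * (besselJ j x : ℂ)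
            - 2 * Real.pi * Complex.I ^ j * ((((c.Q j : ℤ) : ℝ) / (c.den : ℝ) : ℝ) : ℂ)‖
      ≤ (2 * J + 1) * (2 * Real.pi * c.eps) :=
  hx ▸ c.sum_weight_norm_coeff_sub_le h hJ

end Cert

/-! ### A small kernel-decided instance (classical values of `J_0 … J_3` at `1/2`, six digits) -/

/-- Six-digit literals of `J_j(1/2)`, `j = 0,…,3`: `0.938470`, `0.242268`, `0.030604`, `0.002564`
(`N = 6` series terms; accuracy `10⁻⁶`). [cite: DLMF, 10.2.2] -/
def smoke : Cert where
  y := 1 / 2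
  den := 1000000
  N := 6
  eps := 1 / 1000000
  L := 4
  Q := fun j => [938470, 242268, 30604, 2564].getD j 0

/-- The smoke instance checks (kernel decision on rational literals). [cite: DLMF, 10.2.2] -/
theorem smoke_check : smoke.check = true := by decide +kernel

/-- Hence e.g. `|0.938470 − J_0(1/2)| ≤ 10⁻⁶`, …, `|0.002564 − J_3(1/2)| ≤ 10⁻⁶`. [cite: DLMF, 10.2.2] -/
theorem smoke_sound {j : ℕ} (hj : j < 4) :
    |((smoke.Q j : ℤ) : ℝ) / (smoke.den : ℝ) - besselJ j ((smoke.y : ℚ) : ℝ)| ≤ (smoke.eps : ℝ) :=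
  smoke.sound smoke_check hj

end JLit

end Literature.Analysis.FunctionSpaces

end
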